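import Literature.NumberTheory.Sieve.Maynard2016CoupledProduct
import Literature.NumberTheory.Sieve.Maynard2016CouplingSet
import Literature.NumberTheory.Sieve.Maynard2016PrimeDivisorSum
import Literature.NumberTheory.Sieve.Maynard2016TupleArith
import Literature.NumberTheory.Sieve.Maynard2016Growth

/-!
# Maynard (2016), Lemma 6: the bad primes and `∏_{p ∤ W}(1 + η_p) = 1 + o(1)` ((6.13)–(6.14))

Trunk: AntSieve / parity (Maynard 2016 large-gaps ladder, named fact
`Literature.NumberTheory.Sieve.Maynard2016.Lemma6MainTerm` of `Maynard2016Lemma6Split.lean`).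

J. Maynard, *Large gaps between primes*, Ann. of Math. 183 (2016) = arXiv:1408.5110, §6, proof of
Lemma 6, displays (6.13)–(6.14).  The coupled Euler product of `Maynard2016CoupledProduct.lean`
(`LcmEuler.coupledKernel_eq_prod`: `K = E · N · Z · Z'` with `‖E − 1‖ ≤ exp(T) − 1`,
`T = LcmEuler.epsTotal k k p₀ τ Bad`) needs, for Maynard's data (`W = P_w`, modulus `m`, prime `q`,
coupling sets `M_p = couplingSet k x m q p` of `Maynard2016CouplingSet.lean`):
* a finite set `Bad` of primes outside which `p ∤ m` and `M_p = ∅` — here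
  `badPrimes k x m q :=` the prime factors of `N' = badModulus k x m q = 16 m ∏_{i ≠ j} |m q (h_j − h_i) − 1|`
  (`badPrimes_spec`); `N' ≠ 0` as `q ≥ 2` (`badModulus_ne_zero`), and `N' ≤ 16 x (x³+1)^{k²}` when
  `m, q, h_i ≤ x` (`badModulus_le`), whence `Σ_{p ∈ Bad} log p/p ≤ (log₂ x + log(4k²+2) + 3)²`
  (`sum_badPrimes_log_div_le`, from `Maynard2016PrimeDivisorSum`);
* the least prime not dividing `W`: every prime `p ∤ P_w` satisfies `p ≥ p0 x := ⌊w⌋ + 1`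
  (`p0_le_of_not_dvd_Pw`), and `p0 x → ∞`;
* the exponent bound `τ = tauX ε x := 2 √(log x)/log y` (both scales of Lemma 6 live in the cube
  `|ξ| ≤ √log x`, so `|(1+iξ)/log x|, |(1+iτ)/log y| ≤ τ`);
and then **`T → 0` uniformly in `1 ≤ m ≤ x`, `2 ≤ q ≤ x`** (`eventually_epsTotal_le`), which is
Maynard's "`= exp(O(w⁻¹ + (log₂ x)² (log x)^{−1/2+ε}))`" of (6.14).  All statements PROVED (no named facts).

## References

* J. Maynard, *Large gaps between primes*, Ann. of Math. (2) 183 (2016), 915–933; arXiv:1408.5110,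
  §6, proof of Lemma 6, displays (6.13)–(6.14). [Maynard2016LargeGaps]
-/

noncomputable section

open Filter Finset
open scoped BigOperators Topology

namespace Literature.NumberTheory.Sieve

namespace Maynard2016

open LcmEuler

/-! ### The bad modulus `N' = 16 m ∏_{i ≠ j} |m q (h_j − h_i) − 1|` -/

/-- The off-diagonal factor `|m q (h_j − h_i) − 1|` (and `1` on the diagonal). [cite: Maynard2016LargeGaps, §6 display (6.13)] -/
def badFactor (k x m q : ℕ) (i j : Fin k) : ℕ :=
  if i = j then 1 else Int.natAbs ((m : ℤ) * q * ((hTuple k x j : ℤ) - hTuple k x i) - 1)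

/-- `N' := 16 · m · ∏_{i, j} badFactor` — every "bad" prime of (6.13) divides `N'`. [cite: Maynard2016LargeGaps, §6 display (6.13)] -/
def badModulus (k x m q : ℕ) : ℕ :=
  16 * m * ∏ i : Fin k, ∏ j : Fin k, badFactor k x m q i j

/-- `Bad := ` the prime factors of `N'`. [cite: Maynard2016LargeGaps, §6 display (6.13)] -/
def badPrimes (k x m q : ℕ) : Finset ℕ := (badModulus k x m q).primeFactors

/-- `m q (h_j − h_i) ≠ 1` when `q ≥ 2`, so the off-diagonal factors are non-zero. [cite: Maynard2016LargeGaps, §6 display (6.13)] -/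
theorem badFactor_ne_zero {q : ℕ} (hq : 2 ≤ q) (k x m : ℕ) (i j : Fin k) :
    badFactor k x m q i j ≠ 0 := by
  unfold badFactor
  split_ifs with hij
  · exact one_ne_zero
  intro h0
  have h1 : (m : ℤ) * q * ((hTuple k x j : ℤ) - hTuple k x i) = 1 := by
    have := Int.natAbs_eq_zero.1 h0; linarith
  have h2 : (q : ℤ) ∣ 1 := ⟨(m : ℤ) * ((hTuple k x j : ℤ) - hTuple k x i), by rw [← h1]; ring⟩
  have h3 : q ∣ 1 := by exact_mod_cast Int.natCast_dvd_natCast.1 h2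
  have := Nat.le_of_dvd one_pos h3
  omega

/-- `N' ≠ 0` for `m ≥ 1`, `q ≥ 2`. [cite: Maynard2016LargeGaps, §6 display (6.13)] -/
theorem badModulus_ne_zero {m q : ℕ} (hm : 1 ≤ m) (hq : 2 ≤ q) (k x : ℕ) :
    badModulus k x m q ≠ 0 := by
  unfold badModulus
  refine Nat.mul_ne_zero (Nat.mul_ne_zero (by norm_num) (by omega)) ?_
  exact Finset.prod_ne_zero_iff.2 fun i _ => Finset.prod_ne_zero_iff.2 fun j _ =>
    badFactor_ne_zero hq k x m i j

/-- `16 ≤ N'` for `m ≥ 1`, `q ≥ 2`. [cite: Maynard2016LargeGaps, §6 display (6.13)] -/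
theorem sixteen_le_badModulus {m q : ℕ} (hm : 1 ≤ m) (hq : 2 ≤ q) (k x : ℕ) :
    16 ≤ badModulus k x m q := by
  have h1 : 1 ≤ ∏ i : Fin k, ∏ j : Fin k, badFactor k x m q i j :=
    Nat.one_le_iff_ne_zero.2 (Finset.prod_ne_zero_iff.2 fun i _ => Finset.prod_ne_zero_iff.2
      fun j _ => badFactor_ne_zero hq k x m i j)
  unfold badModulus
  calc 16 = 16 * 1 * 1 := by norm_num
    _ ≤ 16 * m * ∏ i : Fin k, ∏ j : Fin k, badFactor k x m q i j :=
        Nat.mul_le_mul (Nat.mul_le_mul_left 16 hm) h1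

/-- `m ∣ N'`. [cite: Maynard2016LargeGaps, §6 display (6.13)] -/
theorem dvd_badModulus_self (k x m q : ℕ) : m ∣ badModulus k x m q :=
  Dvd.intro_left _ rfl |>.mul_right _ |> fun h => by unfold badModulus; exact h

/-- A prime `p` with `M_p ≠ ∅` (i.e. `p ∣ m q (h_j − h_i) − 1` for some `i, j`) divides `N'` (and `i ≠ j`).
[cite: Maynard2016LargeGaps, §6 display (6.13)] -/
theorem dvd_badModulus_of_mem_couplingSet {k x m q p : ℕ} (hp : p.Prime) {ij : Fin k × Fin k}
    (hij : ij ∈ couplingSet k x m q p) : p ∣ badModulus k x m q := by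
  rw [mem_couplingSet] at hij
  obtain ⟨i, j⟩ := ij
  have hne : i ≠ j := by
    rintro rfl
    simp only [sub_self, mul_zero, zero_sub] at hij
    have h1 : (p : ℤ) ∣ 1 := (dvd_neg).1 hij
    have h2 : p ∣ 1 := by exact_mod_cast Int.natCast_dvd_natCast.1 h1
    exact hp.one_lt.ne' (Nat.dvd_one.1 h2)
  have h1 : p ∣ badFactor k x m q i j := by
    unfold badFactor
    rw [if_neg hne]
    exact Int.natCast_dvd.1 hij
  have h2 : badFactor k x m q i j ∣ ∏ i' : Fin k, ∏ j' : Fin k, badFactor k x m q i' j' :=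
    (Finset.dvd_prod_of_mem _ (Finset.mem_univ j)).trans
      (Finset.dvd_prod_of_mem (fun i' => ∏ j' : Fin k, badFactor k x m q i' j') (Finset.mem_univ i))
  unfold badModulus
  exact (h1.trans h2).trans (Dvd.intro_left _ rfl)

/-- **`Bad` does its job**: a prime `p ∉ Bad` satisfies `p ∤ m` and `M_p = ∅` (hypothesis `hBad` of
`LcmEuler.coupledKernel_eq_prod`). [cite: Maynard2016LargeGaps, §6 display (6.13)] -/
theorem badPrimes_spec {k x m q : ℕ} (hm : 1 ≤ m) (hq : 2 ≤ q) (p : ℕ) (hp : p.Prime)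
    (hB : p ∉ badPrimes k x m q) : ¬ p ∣ m ∧ couplingSet k x m q p = ∅ := by
  have hN := badModulus_ne_zero hm hq k x
  have hnd : ¬ p ∣ badModulus k x m q := fun h =>
    hB (Nat.mem_primeFactors.2 ⟨hp, h, hN⟩)
  refine ⟨fun h => hnd (h.trans (dvd_badModulus_self k x m q)), ?_⟩
  rw [Finset.eq_empty_iff_forall_notMem]
  intro ij hij
  exact hnd (dvd_badModulus_of_mem_couplingSet hp hij)

/-! ### Size of `N'` -/

/-- `|m q (h_j − h_i) − 1| ≤ x³ + 1` when `m, q, h_i, h_j ≤ x`. [cite: Maynard2016LargeGaps, §6 display (6.14)] -/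
theorem badFactor_le {k x m q : ℕ} (hm : m ≤ x) (hq : q ≤ x) (hH : ∀ i, hTuple k x i ≤ x)
    (i j : Fin k) : badFactor k x m q i j ≤ x ^ 3 + 1 := by
  unfold badFactor
  split_ifs with hij
  · omega
  have h1 : ((hTuple k x j : ℤ) - hTuple k x i).natAbs ≤ x :=
    Int.natAbs_coe_sub_coe_le_of_le (hH j) (hH i)
  have h2 : ((m : ℤ) * q * ((hTuple k x j : ℤ) - hTuple k x i)).natAbs ≤ x ^ 3 := by
    rw [Int.natAbs_mul, Int.natAbs_mul, Int.natAbs_natCast, Int.natAbs_natCast]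
    calc m * q * ((hTuple k x j : ℤ) - hTuple k x i).natAbs ≤ x * x * x :=
          Nat.mul_le_mul (Nat.mul_le_mul hm hq) h1
      _ = x ^ 3 := by ring
  calc ((m : ℤ) * q * ((hTuple k x j : ℤ) - hTuple k x i) - 1).natAbs
      ≤ ((m : ℤ) * q * ((hTuple k x j : ℤ) - hTuple k x i)).natAbs + (1 : ℤ).natAbs :=
        Int.natAbs_sub_le _ _
    _ ≤ x ^ 3 + 1 := by simpa using h2

/-- `N' ≤ 16 x (x³ + 1)^{k²}` when `m, q, h_i ≤ x`. [cite: Maynard2016LargeGaps, §6 display (6.14)] -/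
theorem badModulus_le {k x m q : ℕ} (hm : m ≤ x) (hq : q ≤ x) (hH : ∀ i, hTuple k x i ≤ x) :
    badModulus k x m q ≤ 16 * x * (x ^ 3 + 1) ^ (k * k) := by
  unfold badModulus
  refine Nat.mul_le_mul (Nat.mul_le_mul_left 16 hm) ?_
  calc ∏ i : Fin k, ∏ j : Fin k, badFactor k x m q i j ≤ ∏ _i : Fin k, (x ^ 3 + 1) ^ k := by
        refine Finset.prod_le_prod' fun i _ => ?_
        calc ∏ j : Fin k, badFactor k x m q i j ≤ (x ^ 3 + 1) ^ (Finset.univ : Finset (Fin k)).card :=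
              Finset.prod_le_pow_card _ _ _ fun j _ => badFactor_le hm hq hH i j
          _ = (x ^ 3 + 1) ^ k := by rw [Finset.card_univ, Fintype.card_fin]
    _ = (x ^ 3 + 1) ^ (k * k) := by
        rw [Finset.prod_const, Finset.card_univ, Fintype.card_fin, ← pow_mul]

/-- `log N' ≤ (4k² + 2) log x` for `x ≥ 16` (and `m, q, h_i ≤ x`). [cite: Maynard2016LargeGaps, §6 display (6.14)] -/
theorem log_badModulus_le {k x m q : ℕ} (hx : 16 ≤ x) (hm : m ≤ x) (hq : q ≤ x)
    (hH : ∀ i, hTuple k x i ≤ x) :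
    Real.log (badModulus k x m q) ≤ (4 * (k : ℝ) * k + 2) * Real.log x := by
  have hx0 : (0 : ℝ) < x := by exact_mod_cast (show 0 < x by omega)
  have hx1 : (1 : ℝ) ≤ x := by exact_mod_cast (show 1 ≤ x by omega)
  have hlogx : 0 ≤ Real.log x := Real.log_nonneg hx1
  have hlog2 : Real.log 2 ≤ Real.log x := Real.log_le_log two_pos (by exact_mod_cast (by omega : 2 ≤ x))
  have hlog16 : Real.log 16 ≤ Real.log x :=
    Real.log_le_log (by norm_num) (by exact_mod_cast hx)
  have hN : (badModulus k x m q : ℝ) ≤ 16 * x * ((x : ℝ) ^ 3 + 1) ^ (k * k) := by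
    exact_mod_cast badModulus_le hm hq hH
  by_cases hN0 : badModulus k x m q = 0
  · rw [hN0]; simp; positivity
  have hNpos : (0 : ℝ) < badModulus k x m q := by exact_mod_cast Nat.pos_of_ne_zero hN0
  -- `x³ + 1 ≤ 2 x³`, `log(2x³) = log 2 + 3 log x ≤ 4 log x`
  have h3 : Real.log ((x : ℝ) ^ 3 + 1) ≤ 4 * Real.log x := by
    have h31 : (x : ℝ) ^ 3 + 1 ≤ 2 * (x : ℝ) ^ 3 := by nlinarith [pow_le_pow_left₀ zero_le_one hx1 3]
    calc Real.log ((x : ℝ) ^ 3 + 1) ≤ Real.log (2 * (x : ℝ) ^ 3) :=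
          Real.log_le_log (by positivity) h31
      _ = Real.log 2 + 3 * Real.log x := by
          rw [Real.log_mul two_ne_zero (by positivity), Real.log_pow]; norm_num
      _ ≤ 4 * Real.log x := by linarith
  calc Real.log (badModulus k x m q) ≤ Real.log (16 * x * ((x : ℝ) ^ 3 + 1) ^ (k * k)) :=
        Real.log_le_log hNpos hN
    _ = Real.log 16 + Real.log x + (k * k : ℕ) * Real.log ((x : ℝ) ^ 3 + 1) := by
        rw [Real.log_mul (by positivity) (by positivity), Real.log_mul (by norm_num) hx0.ne',
          Real.log_pow]
    _ ≤ Real.log x + Real.log x + (k * k : ℕ) * (4 * Real.log x) := by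
        gcongr
    _ = (4 * (k : ℝ) * k + 2) * Real.log x := by push_cast; ring

/-- **`Σ_{p ∈ Bad} log p / p ≤ (log₂ x + log(4k² + 2) + 3)²`** for `x ≥ 16`, `1 ≤ m ≤ x`, `2 ≤ q ≤ x`,
`h_i ≤ x`. [cite: Maynard2016LargeGaps, §6 display (6.14)] -/
theorem sum_badPrimes_log_div_le {k x m q : ℕ} (hx : 16 ≤ x) (hm1 : 1 ≤ m) (hm : m ≤ x)
    (hq2 : 2 ≤ q) (hq : q ≤ x) (hH : ∀ i, hTuple k x i ≤ x) :
    ∑ p ∈ badPrimes k x m q, Real.log p / p ≤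
      (Real.log (Real.log x) + Real.log (4 * (k : ℝ) * k + 2) + 3) ^ 2 := by
  have h16 := sixteen_le_badModulus hm1 hq2 k x
  have h1 := sum_primeFactors_log_div_le h16
  refine h1.trans ?_
  have hx1 : (1 : ℝ) < x := by exact_mod_cast (show 1 < x by omega)
  have hlogx : 0 < Real.log x := Real.log_pos hx1
  have hNpos : (1 : ℝ) < badModulus k x m q := by exact_mod_cast (show 1 < badModulus k x m q by omega)
  have hlogN : 0 < Real.log (badModulus k x m q) := Real.log_pos hNpos
  have h2 : Real.log (Real.log (badModulus k x m q)) ≤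
      Real.log (Real.log x) + Real.log (4 * (k : ℝ) * k + 2) := by
    rw [← Real.log_mul hlogx.ne' (by positivity)]
    refine Real.log_le_log hlogN ?_
    rw [mul_comm]
    exact log_badModulus_le hx hm hq hH
  have hc : 0 ≤ Real.log (4 * (k : ℝ) * k + 2) := Real.log_nonneg (by nlinarith [sq_nonneg (k : ℝ)])
  -- `log log N' + 3 ≥ log log 16 + 3 > 0`
  have hlhs : 0 ≤ Real.log (Real.log (badModulus k x m q)) + 3 := by
    have h16' : Real.log 16 ≤ Real.log (badModulus k x m q) :=
      Real.log_le_log (by norm_num) (by exact_mod_cast h16)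
    have hl16 : 1 ≤ Real.log 16 := by
      rw [show (16 : ℝ) = 2 ^ 4 by norm_num, Real.log_pow]; norm_num
      linarith [Real.log_two_gt_d9]
    have : 0 ≤ Real.log (Real.log (badModulus k x m q)) :=
      Real.log_nonneg (hl16.trans h16')
    linarith
  exact pow_le_pow_left₀ hlhs (by linarith) 2

/-! ### `p₀ = ⌊w⌋ + 1`, `τ = 2√(log x)/log y`, and `T → 0` -/

/-- `p₀ := ⌊w⌋ + 1`: every prime not dividing `P_w` is at least `p₀`. [cite: Maynard2016LargeGaps, §4 (definition of P_w)] -/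
def p0 (x : ℕ) : ℕ := ⌊wFun x⌋₊ + 1

/-- `τ := 2 √(log x) / log y`. [cite: Maynard2016LargeGaps, §6 display (6.13)] -/
def tauX (ε : ℝ) (x : ℕ) : ℝ := 2 * Real.sqrt (Real.log x) / Real.log (y ε x)

/-- A prime `p ∤ P_w` satisfies `p ≥ ⌊w⌋ + 1`. [cite: Maynard2016LargeGaps, §4 (definition of P_w)] -/
theorem p0_le_of_not_dvd_Pw {p x : ℕ} (hp : p.Prime) (h : ¬ p ∣ Pw x) : p0 x ≤ p := by
  unfold p0
  unfold Pw at h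
  rw [hp.dvd_primorial_iff, not_le] at h
  omega

/-- `w < p₀`, so `p₀ → ∞`; in particular `2 ≤ p₀` and `7k ≤ p₀` eventually. [cite: Maynard2016LargeGaps, §4 (choice of w)] -/
theorem eventually_le_p0 (C : ℝ) : ∀ᶠ x : ℕ in atTop, C ≤ (p0 x : ℝ) := by
  filter_upwards [eventually_le_wFun C] with x hx
  unfold p0
  push_cast
  linarith [Nat.lt_floor_add_one (wFun x)]

/-- `h_i ≤ x` for all `i < k`, eventually in `x` (`h_i ≤ p_{π(k)+k} P_w ≤ p_{π(k)+k} (log₃ x)³`).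
[cite: Maynard2016LargeGaps, §4 (definition of h_j)] -/
theorem eventually_hTuple_le (k : ℕ) : ∀ᶠ x : ℕ in atTop, ∀ i : Fin k, hTuple k x i ≤ x := by
  set P : ℕ := Nat.nth Nat.Prime (Nat.primeCounting k + k) with hP
  have hP0 : (0 : ℝ) < P := by exact_mod_cast (Nat.prime_nth_prime _).pos
  have hsq := (Real.isLittleO_pow_log_id_atTop (n := 3)).bound (show (0 : ℝ) < 1 / P by positivity)
  have hreal : ∀ᶠ X : ℝ in atTop, (P : ℝ) * (Real.log X) ^ 3 ≤ X := by
    filter_upwards [hsq, eventually_ge_atTop (1 : ℝ)] with X hX hX1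
    rw [Real.norm_eq_abs, Real.norm_eq_abs, id, abs_of_nonneg (pow_nonneg (Real.log_nonneg hX1) 3),
      abs_of_nonneg (by linarith)] at hX
    rw [← le_div_iff₀' hP0]
    simpa [div_eq_inv_mul, one_div] using hX
  filter_upwards [tendsto_natCast_atTop_atTop.eventually hreal, eventually_iteratedLogs] with x hx hlogs
  obtain ⟨hL, hL₂, hL₃, hL₃L₂, hL₂L, -, -⟩ := hlogs
  intro i
  have h1 : hTuple k x i ≤ P * Pw x := by
    unfold hTuple
    exact Nat.mul_le_mul_right _ (nth_prime_le_of_fin k i)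
  have h2 : (Pw x : ℝ) ≤ (Real.log (Real.log (Real.log x))) ^ 3 := Pw_le_log₃_pow hL₃
  have h3 : (Real.log (Real.log (Real.log x))) ^ 3 ≤ (Real.log x) ^ 3 :=
    pow_le_pow_left₀ (by linarith) (by linarith) 3
  have h4 : (hTuple k x i : ℝ) ≤ x := by
    calc (hTuple k x i : ℝ) ≤ P * Pw x := by exact_mod_cast h1
      _ ≤ P * (Real.log x) ^ 3 := mul_le_mul_of_nonneg_left (h2.trans h3) hP0.le
      _ ≤ x := hx
  exact_mod_cast h4

/-- `(log log x)^n / √(log x) → 0` along `x : ℕ`. [folklore] -/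
private theorem tendsto_loglog_pow_div_sqrt_log (n : ℕ) :
    Tendsto (fun x : ℕ => (Real.log (Real.log x)) ^ n / Real.sqrt (Real.log x)) atTop (𝓝 0) := by
  have h := (isLittleO_log_rpow_rpow_atTop (n : ℝ) (show (0 : ℝ) < 1 / 2 by norm_num)).tendsto_div_nhds_zero
  have h' : Tendsto (fun L : ℝ => (Real.log L) ^ n / Real.sqrt L) atTop (𝓝 0) := by
    refine h.congr' ?_
    filter_upwards [eventually_ge_atTop (1 : ℝ)] with L hL
    rw [Real.rpow_natCast, Real.sqrt_eq_rpow]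
  exact (h'.comp Real.tendsto_log_atTop).comp tendsto_natCast_atTop_atTop

/-- **`T → 0` uniformly** ((6.14)): for `ε < 1`, `k`, `η > 0`: eventually in `x`, for all `1 ≤ m ≤ x`
and `2 ≤ q ≤ x`, `epsTotal k k p₀ τ Bad ≤ η` with `p₀ = ⌊w⌋+1`, `τ = 2√(log x)/log y`,
`Bad = badPrimes k x m q`. [cite: Maynard2016LargeGaps, §6 display (6.14)] -/
theorem eventually_epsTotal_le {ε : ℝ} (hε : ε < 1) (k : ℕ) {η : ℝ} (hη : 0 < η) :
    ∀ᶠ x : ℕ in atTop, ∀ m q : ℕ, 1 ≤ m → m ≤ x → 2 ≤ q → q ≤ x →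
      epsTotal k k (p0 x) (tauX ε x) (badPrimes k x m q) ≤ η := by
  -- constants
  set A : ℝ := 6 ^ (k + k) with hA
  set C₂ : ℝ := badConst k k with hC₂
  set Ck : ℝ := Real.log (4 * (k : ℝ) * k + 2) + 3 with hCk
  have hA0 : 0 < A := by positivity
  have hC₂0 : 0 ≤ C₂ := by rw [hC₂]; unfold badConst goodConst; positivity
  have hCk0 : 0 ≤ Ck := by
    have : 0 ≤ Real.log (4 * (k : ℝ) * k + 2) := Real.log_nonneg (by nlinarith [sq_nonneg (k : ℝ)])
    rw [hCk]; linarith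
  have hB0 : 0 ≤ 16 * ((k : ℝ) + k * k) := by positivity
  -- the two small quantities: `1/p₀ → 0` and `(L₂ + Ck)³/√L → 0`
  have h1 : Tendsto (fun x : ℕ => (p0 x : ℝ)⁻¹) atTop (𝓝 0) := by
    refine tendsto_inv_atTop_zero.comp ?_
    refine tendsto_atTop_atTop.2 fun C => ?_
    obtain ⟨N, hN⟩ := (eventually_le_p0 C).exists_forall_of_atTop
    exact ⟨N, hN⟩
  have h2 : Tendsto (fun x : ℕ => (Real.log (Real.log x) + Ck) ^ 3 / Real.sqrt (Real.log x))
      atTop (𝓝 0) := by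
    -- `(L₂ + Ck)³ ≤ 8 L₂³` once `L₂ ≥ Ck`; squeeze
    have h8 := (tendsto_loglog_pow_div_sqrt_log 3).const_mul 8
    rw [mul_zero] at h8
    have hT₂ : Tendsto (fun x : ℕ => Real.log (Real.log (x : ℝ))) atTop atTop :=
      (Real.tendsto_log_atTop.comp Real.tendsto_log_atTop).comp tendsto_natCast_atTop_atTop
    refine squeeze_zero' ?_ ?_ h8
    · filter_upwards [eventually_iteratedLogs] with x hx
      obtain ⟨hL, hL₂, -⟩ := hx
      exact div_nonneg (pow_nonneg (by linarith) 3) (Real.sqrt_nonneg _)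
    · filter_upwards [hT₂.eventually_ge_atTop Ck, eventually_iteratedLogs] with x hx hlogs
      obtain ⟨hL, hL₂, -⟩ := hlogs
      rw [← mul_div_assoc]
      refine div_le_div_of_nonneg_right ?_ (Real.sqrt_nonneg _)
      have : Real.log (Real.log x) + Ck ≤ 2 * Real.log (Real.log x) := by linarith
      calc (Real.log (Real.log x) + Ck) ^ 3 ≤ (2 * Real.log (Real.log x)) ^ 3 :=
            pow_le_pow_left₀ (by linarith) this 3
        _ = 8 * (Real.log (Real.log x)) ^ 3 := by ring
  -- the majorant `A (2 C₂ /p₀ + 16(k+k²) (2/(1−ε)) (L₂+Ck)³/√L) → 0`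
  have hmaj : Tendsto (fun x : ℕ => A * (2 * C₂ * (p0 x : ℝ)⁻¹ +
      16 * ((k : ℝ) + k * k) * (2 / (1 - ε) * ((Real.log (Real.log x) + Ck) ^ 3 /
        Real.sqrt (Real.log x))))) atTop (𝓝 0) := by
    have := ((h1.const_mul (2 * C₂)).add ((h2.const_mul (2 / (1 - ε))).const_mul
      (16 * ((k : ℝ) + k * k)))).const_mul A
    simpa using this
  filter_upwards [hmaj.eventually_le_const hη, eventually_iteratedLogs, eventually_hTuple_le k,
    eventually_ge_atTop 16] with x hx hlogs hH hx16
  obtain ⟨hL, hL₂, hL₃, hL₃L₂, hL₂L, -, -⟩ := hlogs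
  intro m q hm1 hm hq2 hq
  refine le_trans ?_ hx
  -- pointwise: `epsTotal ≤ majorant`
  have hL0 : 0 < Real.log x := by linarith
  have hsqrt : 0 < Real.sqrt (Real.log x) := Real.sqrt_pos.2 hL0
  have hsq : Real.sqrt (Real.log x) * Real.sqrt (Real.log x) = Real.log x := Real.mul_self_sqrt hL0.le
  have hε1 : 0 < 1 - ε := by linarith
  have hly : Real.log (y ε x) = (1 - ε) * (Real.log x * Real.log (Real.log (Real.log x)) /
      Real.log (Real.log x)) := log_y ε x
  have hlypos : 0 < Real.log (y ε x) := by
    rw [hly]; exact mul_pos hε1 (div_pos (mul_pos hL0 (by linarith)) (by linarith))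
  have hp0pos : (0 : ℝ) < p0 x := by unfold p0; positivity
  have hτ0 : 0 ≤ tauX ε x := by unfold tauX; positivity
  -- `τ ≤ (2/(1−ε)) L₂ /√L` (using `L₃ ≥ 1`)
  have hτ : tauX ε x ≤ 2 / (1 - ε) * (Real.log (Real.log x) / Real.sqrt (Real.log x)) := by
    unfold tauX
    rw [div_le_iff₀ hlypos, hly]
    have hL₂0 : 0 < Real.log (Real.log x) := by linarith
    rw [show 2 / (1 - ε) * (Real.log (Real.log x) / Real.sqrt (Real.log x)) *
        ((1 - ε) * (Real.log x * Real.log (Real.log (Real.log x)) / Real.log (Real.log x))) =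
        2 * Real.sqrt (Real.log x) * Real.log (Real.log (Real.log x)) by
      field_simp; nlinarith [hsq]]
    nlinarith
  have hS := sum_badPrimes_log_div_le (k := k) hx16 hm1 hm hq2 hq hH
  have hS0 : 0 ≤ ∑ p ∈ badPrimes k x m q, Real.log p / p :=
    Finset.sum_nonneg fun p hp => div_nonneg
      (Real.log_nonneg (by exact_mod_cast (Nat.prime_of_mem_primeFactors hp).one_lt.le))
      (Nat.cast_nonneg _)
  have hL₂Ck : 1 ≤ Real.log (Real.log x) + Ck := by linarith
  -- `τ Σ ≤ (2/(1−ε)) (L₂/√L) (L₂+Ck)² ≤ (2/(1−ε)) (L₂+Ck)³/√L`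
  have hτS : tauX ε x * ∑ p ∈ badPrimes k x m q, Real.log p / p ≤
      2 / (1 - ε) * ((Real.log (Real.log x) + Ck) ^ 3 / Real.sqrt (Real.log x)) := by
    calc tauX ε x * ∑ p ∈ badPrimes k x m q, Real.log p / p
        ≤ (2 / (1 - ε) * (Real.log (Real.log x) / Real.sqrt (Real.log x))) *
            (Real.log (Real.log x) + Ck) ^ 2 := by
          rw [hCk, ← add_assoc]
          exact mul_le_mul hτ hS hS0 (by positivity)
      _ ≤ 2 / (1 - ε) * ((Real.log (Real.log x) + Ck) ^ 3 / Real.sqrt (Real.log x)) := by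
          rw [mul_assoc]
          refine mul_le_mul_of_nonneg_left ?_ (by positivity)
          rw [div_mul_eq_mul_div]
          refine div_le_div_of_nonneg_right ?_ hsqrt.le
          have hL₂le : Real.log (Real.log x) ≤ Real.log (Real.log x) + Ck := by linarith
          nlinarith [mul_le_mul_of_nonneg_right hL₂le (sq_nonneg (Real.log (Real.log x) + Ck))]
  unfold epsTotal
  rw [← hA, ← hC₂]
  refine mul_le_mul_of_nonneg_left ?_ hA0.le
  refine add_le_add ?_ ?_
  · rw [div_eq_mul_inv]
  · exact mul_le_mul_of_nonneg_left hτS hB0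

end Maynard2016

end Literature.NumberTheory.Sieve

end
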